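import Literature.Computability.Complexity.PRelHierarchy
import Literature.Computability.Complexity.CircuitEval
import Literature.Computability.Complexity.PPolyComplement
import Literature.Computability.Complexity.CircuitClassesProofs
import HarnessLib

/-!
# `NP ⊆ P/poly` implies `PH ⊆ P/poly`; `P/poly = NP/poly` implies `P/poly = PH/poly`

Trunk T-CPLX-CORE. The advice version of "`P = NP` implies `P = PH`" used by Bürgisser
(*Cook's versus Valiant's hypothesis*, TCS 235 (2000), p. 79, proof of Cor. 1.2: "It is
well-known that `P = NP` implies `P = PH` (cf. [12]). A similar argument shows that
`P/poly = NP/poly` implies `P/poly = PH/poly`"; Karp–Lipton 1982, §1, advice classes), proved for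
the tree's quantifier definition of `PH` (`PolyHierarchy.lean`) and advice operator `polyAdvice`
(Arora–Barak 2009, Def. 6.16):

* `polyExists_PPoly_subset_polyAdvice_NP` — **`∃ᵖ·(P/poly) ⊆ NP/poly`**, unconditionally: if
  `x ∈ L ↔ ∃ y, |y| ≤ q(|x|) ∧ ⟨x, y⟩ ∈ L'` with `L' ∈ P/poly`, hard-wire the circuits of `L'` for
  the `q(n) + 1` witness lengths into ONE circuit `Cₙ` on the string `⟨x, v⟩`, `|v| = q(n)`
  (`Cₙ = ⋁_{m ≤ q(n)} C'_{n,m}(x, v↾m)`), give its description `desc Cₙ` (`CircuitEval.lean`) as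
  advice, and let the `NP` machine guess `v` and run the polynomial-time circuit evaluator
  (`CircEval.EvalLang ∈ P`) on `⟨⟨x, v⟩, desc Cₙ⟩`, reached from the certificate format
  `⟨⟨x, desc Cₙ⟩, v⟩` by a polynomial-time shuffle of the pair components (`exists_shuffle_mem_FP`);
* `SigmaP_subset_PPoly_of_NP_subset_PPoly`, `PH_subset_PPoly_of_NP_subset_PPoly` — by
  induction on the level, `Σₖ₊₁ᵖ = ∃ᵖ·coΣₖᵖ ⊆ ∃ᵖ·(P/poly) ⊆ NP/poly ⊆ (P/poly)/poly = P/poly`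
  (`co P/poly = P/poly`, `co_PPoly_holds`; `(P/poly)/poly ⊆ P/poly`, `polyAdvice_subset_PPoly`);
* `polyAdvice_PH_eq_polyAdvice_P_of_NP_subset_PPoly` and Bürgisser's form
  `polyAdvice_P_eq_polyAdvice_PH_of_polyAdvice_P_eq_polyAdvice_NP`
  (`P/poly-advice = NP/poly ⟹ P/poly-advice = PH/poly`), using `P/poly = P/poly-advice`
  (`PPoly_eq_polyAdvice_P_holds`, Arora–Barak Thm. 6.18) and `NP ⊆ NP/poly`
  (`NP_subset_polyAdvice_NP'`).

## References

* P. Bürgisser, *Cook's versus Valiant's hypothesis*, Theoret. Comput. Sci. 235 (2000) 71–88,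
  p. 79 (proof of Cor. 1.2).
* R. M. Karp, R. J. Lipton, *Turing machines that take advice*, Enseign. Math. 28 (1982)
  191–209, §1; STOC 1980 version *Some connections between nonuniform and uniform complexity
  classes*.
* S. Arora, B. Barak, *Computational Complexity: A Modern Approach*, CUP 2009, Def. 5.3
  (`Σₖᵖ`), Def. 6.5, Def. 6.16, Thm. 6.18 (and its proof: circuit evaluation in `P`), Thm. 6.19
  (Karp–Lipton).
-/

noncomputable section

namespace Literature.Computability.Complexity

open scoped Classical
open _root_.Computability Polynomial CircEval

/-! ### A polynomial-time shuffle of pair components -/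

/-- The shuffle `⟨⟨x, d⟩, y⟩ ↦ ⟨⟨x, y⟩, d⟩` (moving the certificate next to the input and the
advice to the end) is polynomial time: it is `pairFn (pairFn (fstP ∘ fstP) sndP) (sndP ∘ fstP)`
(projections and pairing of `FP` maps, `PRelHierarchy.lean`). [folklore] -/
theorem exists_shuffle_mem_FP : ∃ sh : List Bool → List Bool, sh ∈ FP ∧
    ∀ x d y : List Bool, sh (boolPair (boolPair x d) y) = boolPair (boolPair x y) d :=
  ⟨pairFn (pairFn (fstP ∘ fstP) sndP) (sndP ∘ fstP),
    pairFn_mem_FP (pairFn_mem_FP (comp_mem_FP fstP_mem_FP fstP_mem_FP) sndP_mem_FP)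
      (comp_mem_FP sndP_mem_FP fstP_mem_FP),
    fun x d y => by simp⟩

/-! ### Circuits: a disjunction, and reading the components of a paired string -/

/-- The disjunction of `T` input bits has a `B₂`-straight-line program with `T + 1` gates (a
chain of binary `∨` gates after one constant; Vollmer 1999, §1.1; a copy, in this namespace and
import cone, of `Literature.Computability.AlgebraicComplexity.cktSize_exists_fin` of `BurgisserBooleanParts.lean`). [cite: Vollmer1999, §1.1] -/
theorem cktSize_anyFin : ∀ T : ℕ,
    CktSize B2 (fun (b : Fin T → Bool) (_ : Unit) => decide (∃ i, b i = true)) (T + 1)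
  | 0 => ((cktSize_const (Fin 0) false).of_le (by omega)).congr fun b _ => by simp
  | T + 1 => by
    have ih := cktSize_anyFin T
    have h1 : CktSize B2 (fun (b : Fin (T + 1) → Bool) =>
        Sum.elim (fun (_ : Unit) => decide (∃ i : Fin T, b (Fin.castSucc i) = true))
          (fun (_ : Unit) => b (Fin.last T))) ((T + 1) + 0) :=
      ((ih.rewire Fin.castSucc).congr fun b _ => rfl).pair
        ((CktSize.proj B2 fun (_ : Unit) => Fin.last T).congr fun b _ => rfl)
    have h2 := h1.comp (cktSize_or (ι := Unit ⊕ Unit) (Sum.inl ()) (Sum.inr ()))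
    refine (h2.of_le (by omega)).congr fun b _ => ?_
    simp only [Sum.elim_inl, Sum.elim_inr]
    cases hlast : b (Fin.last T) <;> simp [hlast, Fin.exists_fin_succ']

/-- Reading the two components back off the bit vector `pairVec u v` of `⟨u, v⟩` (`|u| = n`,
`|v| = m`): bit `i` of `u` sits at position `2i` (the first copy), bit `j` of `v` at position
`2n + 2 + j` (Arora–Barak 2009, §0.1). [cite: AroraBarakCC2009, §0.1] -/
theorem pairVec_positions {n m : ℕ} (u : Fin n → Bool) (v : Fin m → Bool) :
    (fun s : Fin n ⊕ Fin m => pairVec u v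
      (Sum.elim (fun i : Fin n => Fin.castAdd m (Fin.castAdd 2 ⟨2 * (i : ℕ), by omega⟩))
        (fun j : Fin m => Fin.natAdd (2 * n + 2) j) s)) = Sum.elim u v := by
  funext s
  rcases s with i | j
  · simp only [Sum.elim_inl, pairVec, Fin.append_left]
    congr 1
    ext
    simp
  · simp only [Sum.elim_inr, pairVec, Fin.append_right]

/-! ### Lists versus bit vectors -/

/-- A list read through a cast of its index type is the function it was built from. [folklore] -/
theorem get_comp_cast_of_ofFn_eq {N : ℕ} {f : Fin N → Bool} {w : List Bool} (h : List.ofFn f = w)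
    (h' : N = w.length) : (fun i : Fin N => w.get (Fin.cast h' i)) = f := by
  subst h
  funext i
  rw [List.get_ofFn]
  rfl

/-- `ofFn` of a list read through a cast of its index type is the list. [folklore] -/
theorem ofFn_get_cast {w : List Bool} {N : ℕ} (h : N = w.length) :
    List.ofFn (fun i : Fin N => w.get (Fin.cast h i)) = w := by
  subst h
  exact List.ofFn_get w

/-- The circuit evaluator on a description of a circuit whose input length is only
propositionally the length of the input string (`CircEval.evalFn_boolPair_desc` transported
along `w.length = N`). [cite: AroraBarak2009, Thm. 6.18 (proof)] -/
theorem evalFn_boolPair_desc_cast {N : ℕ} (C : Circuit (Fin N)) (hC : ∀ g ∈ C.gates, g.arity ≤ 2)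
    (w : List Bool) (h : N = w.length) :
    evalFn (boolPair w (desc C)) = [C.eval fun i => w.get (Fin.cast h i)] := by
  subst h
  rw [evalFn_boolPair_desc w C hC]
  rfl

/-! ### `∃ᵖ·(P/poly) ⊆ NP/poly` -/

/-- **One circuit for all witness lengths.** For `L' ∈ P/poly` and a bound `q` there are, for
every `n`, a `B₂`-circuit `Cₙ` on `2n + 2 + q(n)` inputs of size `≤ S(n)`, `S` a polynomial,
such that on the bit vector of `⟨x, v⟩` (`|x| = n`, `|v| = q(n)`) it outputs `1` iff
`⟨x, v↾m⟩ ∈ L'` for some `m ≤ q(n)`: bundle the circuits of `L'` on pairs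
(`exists_cktSize_boolPair_of_mem_PPoly`) for the `q(n) + 1` prefix lengths, feed them the prefixes
(re-wiring), take the disjunction (`cktSize_anyFin`), and read `x`, `v` off the paired string
(`pairVec_positions`). (Arora–Barak 2009, Def. 6.5; the hard-wiring step of Karp–Lipton type arguments.)
[cite: AroraBarak2009, Def. 6.5 and Thm. 6.18 (proof)] -/
theorem exists_circuit_existsPrefix {L' : Language Bool} (hL' : L' ∈ PPoly) (q : Polynomial ℕ) :
    ∃ S : Polynomial ℕ, ∀ n : ℕ, ∃ C : Circuit (Fin (2 * n + 2 + q.eval n)),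
      C.IsOver B2 ∧ C.size ≤ S.eval n ∧
        ∀ (u : Fin n → Bool) (v : Fin (q.eval n) → Bool),
          C.eval (pairVec u v) = decide (∃ m : Fin (q.eval n + 1),
            boolPair (List.ofFn u) (List.ofFn fun j : Fin m =>
              v (Fin.castLE (Nat.lt_succ_iff.1 m.2) j)) ∈ L') := by
  obtain ⟨r, hr⟩ := exists_cktSize_boolPair_of_mem_PPoly hL'
  -- size of the circuit for pairs `(n, m)`, monotone in `m`
  set sz : ℕ → ℕ → ℕ := fun n m => (2 * n + 2 + m) + r.eval (2 * n + 2 + m) with hsz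
  have hsz_mono : ∀ n {m m' : ℕ}, m ≤ m' → sz n m ≤ sz n m' := fun n m m' h => by
    simp only [hsz]
    have := TM2Iter.eval_mono r (show 2 * n + 2 + m ≤ 2 * n + 2 + m' by omega)
    omega
  refine ⟨(q + 1) * ((2 * X + 2 + q) + r.comp (2 * X + 2 + q)) + (q + 2), fun n => ?_⟩
  set Q := q.eval n with hQ
  -- the bundled prefix circuits on inputs `Fin n ⊕ Fin Q`
  have hbits : ∀ m : Fin (Q + 1), CktSize B2 (fun (w : Fin n ⊕ Fin Q → Bool) (_ : Unit) =>
      L'.boolIndicator (boolPair (List.ofFn fun i => w (.inl i))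
        (List.ofFn fun j : Fin m => w (.inr (Fin.castLE (Nat.lt_succ_iff.1 m.2) j))))) (sz n Q) := by
    intro m
    refine (((hr n m).rewire (ι' := Fin n ⊕ Fin Q)
      (Sum.map id (Fin.castLE (Nat.lt_succ_iff.1 m.2)))).of_le
        (hsz_mono n (Nat.lt_succ_iff.1 m.2))).congr fun w _ => ?_
    rfl
  have hpi := CktSize.pi_const hbits
  have hF := hpi.comp (cktSize_anyFin (Q + 1))
  -- read the components off the paired string
  have hE := hF.rewire (ι' := Fin (2 * n + 2 + Q))
    (Sum.elim (fun i : Fin n => Fin.castAdd Q (Fin.castAdd 2 ⟨2 * (i : ℕ), by omega⟩))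
      (fun j : Fin Q => Fin.natAdd (2 * n + 2) j))
  obtain ⟨C, hCB, hCs, hCe⟩ := hE.toCircuit
  refine ⟨C, hCB, hCs.trans (le_of_eq ?_), fun u v => ?_⟩
  · simp [hsz, hQ, Fintype.card_fin]
  · rw [hCe, pairVec_positions u v]
    simp only [Sum.elim_inl, Sum.elim_inr]
    by_cases h : ∃ m : Fin (Q + 1), boolPair (List.ofFn u)
        (List.ofFn fun j : Fin m => v (Fin.castLE (Nat.lt_succ_iff.1 m.2) j)) ∈ L'
    · rw [decide_eq_true h, decide_eq_true]
      obtain ⟨m, hm⟩ := h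
      exact ⟨m, (Set.mem_iff_boolIndicator _ _).1 hm⟩
    · rw [decide_eq_false h, decide_eq_false]
      rintro ⟨m, hm⟩
      exact h ⟨m, (Set.mem_iff_boolIndicator _ _).2 hm⟩

/-- **`∃ᵖ·(P/poly) ⊆ NP/poly`.** If `x ∈ L ↔ ∃ y, |y| ≤ q(|x|) ∧ ⟨x, y⟩ ∈ L'` with `L' ∈ P/poly`,
then `L ∈ NP/poly`: advice `desc Cₙ` (the circuit of `exists_circuit_existsPrefix`, encoded for the
evaluator of `CircuitEval.lean`), `NP` language
`U = {z | ∃ v, |v| ≤ q(|z|) ∧ ⟨z, v⟩ ∈ V}` with the polynomial-time witness test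
`V = sh⁻¹(EvalLang) ⊓ {⟨⟨x, d⟩, v⟩ | |v| = q(|x|)}` (`sh` the shuffle of `exists_shuffle_mem_FP`) ("guess the witness, evaluate the
hard-wired circuit"; Karp–Lipton 1982, §1; Arora–Barak 2009, proof of Thm. 6.18 for the
evaluation). [cite: KarpLipton1980, §1] [cite: AroraBarak2009, Thm. 6.18 (proof)] -/
theorem polyExists_PPoly_subset_polyAdvice_NP : polyExists PPoly ⊆ polyAdvice Nondeterministic.NP := by
  rintro L ⟨L', hL', q, hq⟩
  obtain ⟨S, hS⟩ := exists_circuit_existsPrefix hL' q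
  choose C hCB hCs hCe using hS
  have har : ∀ n, ∀ g ∈ (C n).gates, g.arity ≤ 2 := fun n g hg => hCB n g hg
  obtain ⟨sh, hshFP, hsh⟩ := exists_shuffle_mem_FP
  -- the witness test and the `NP` language
  let V : Language Bool := sh ⁻¹' EvalLang ⊓ mapFstFn fstP ⁻¹' LenEq q
  have hV : V ∈ Classes.P := inter_mem_P (preimage_mem_P EvalLang_mem_P hshFP)
    (preimage_mem_P (LenEq_mem_P q) (mapFstFn_mem_FP fstP_mem_FP))
  have hVmem : ∀ x d v : List Bool, boolPair (boolPair x d) v ∈ V ↔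
      evalFn (boolPair (boolPair x v) d) = [true] ∧ v.length = q.eval x.length := by
    intro x d v
    change sh (boolPair (boolPair x d) v) ∈ EvalLang ∧
      mapFstFn fstP (boolPair (boolPair x d) v) ∈ LenEq q ↔ _
    rw [hsh, mapFstFn_boolPair, fstP_boolPair, boolPair_mem_LenEq]
    rfl
  let U : Language Bool := {z | ∃ v : List Bool, v.length ≤ q.eval z.length ∧ boolPair z v ∈ V}
  have hU : U ∈ Nondeterministic.NP := ⟨V, hV, q, fun z => Iff.rfl⟩
  -- the advice and its length
  refine ⟨U, hU, fun n => desc (C n), (S + 1) * (8 * ((2 * X + 2 + q) + S) + 10), fun n => ?_,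
    fun x => ?_⟩
  · refine (length_desc_le (C n)).trans ?_
    have hs := hCs n
    simp only [eval_mul, eval_add, eval_one, eval_X, eval_ofNat]
    exact Nat.mul_le_mul (by omega) (by omega)
  · -- the evaluator on `⟨⟨x, v⟩, desc Cₙ⟩` for `|v| = q(|x|)`
    have hev : ∀ v : List Bool, ∀ hv : v.length = q.eval x.length,
        evalFn (boolPair (boolPair x v) (desc (C x.length))) =
          [decide (∃ m : Fin (q.eval x.length + 1), boolPair x (List.ofFn fun j : Fin m =>
            v.get (Fin.cast hv.symm (Fin.castLE (Nat.lt_succ_iff.1 m.2) j))) ∈ L')] := by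
      intro v hv
      have hlen : 2 * x.length + 2 + q.eval x.length = (boolPair x v).length := by
        rw [length_boolPair, hv]
      rw [evalFn_boolPair_desc_cast (C x.length) (har x.length) (boolPair x v) hlen]
      have hvec : (fun i : Fin (2 * x.length + 2 + q.eval x.length) =>
          (boolPair x v).get (Fin.cast hlen i)) =
            pairVec x.get (fun j => v.get (Fin.cast hv.symm j)) := by
        refine get_comp_cast_of_ofFn_eq ?_ hlen
        rw [ofFn_pairVec, List.ofFn_get, ofFn_get_cast hv.symm]
      rw [hvec, hCe, List.ofFn_get]
    change x ∈ L ↔ ∃ v : List Bool, v.length ≤ q.eval (boolPair x (desc (C x.length))).length ∧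
      boolPair (boolPair x (desc (C x.length))) v ∈ V
    rw [hq x]
    constructor
    · -- pad the witness `y` to length `q(|x|)`
      rintro ⟨y, hy, hyL⟩
      let v : List Bool := List.ofFn fun j : Fin (q.eval x.length) =>
        if h : (j : ℕ) < y.length then y.get ⟨j, h⟩ else false
      have hv : v.length = q.eval x.length := List.length_ofFn
      refine ⟨v, ?_, ?_⟩
      · rw [hv]
        exact TM2Iter.eval_mono q (by rw [length_boolPair]; omega)
      · rw [hVmem, hev v hv]
        refine ⟨?_, hv⟩
        rw [List.cons.injEq, decide_eq_true_iff]
        refine ⟨⟨⟨y.length, Nat.lt_succ_of_le hy⟩, ?_⟩, rfl⟩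
        have hfun : (fun j : Fin y.length => v.get (Fin.cast hv.symm
            (Fin.castLE (Nat.lt_succ_iff.1 (Nat.lt_succ_of_le hy)) j))) = y.get := by
          funext j
          simp only [v, List.get_ofFn]
          simp [Fin.cast, j.2]
        simp only [hfun, List.ofFn_get]
        exact hyL
    · rintro ⟨v, -, hvV⟩
      obtain ⟨hE, hv⟩ := (hVmem _ _ _).1 hvV
      rw [hev v hv, List.cons.injEq, decide_eq_true_iff] at hE
      obtain ⟨⟨m, hm⟩, -⟩ := hE
      exact ⟨_, by simpa [Nat.lt_succ_iff] using m.2, hm⟩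

/-! ### The levels of `PH` under `NP ⊆ P/poly` -/

/-- **`NP ⊆ P/poly` implies `Σₖᵖ ⊆ P/poly` for every `k`** (induction on `k`:
`Σₖ₊₁ᵖ = ∃ᵖ·coΣₖᵖ ⊆ ∃ᵖ·(P/poly) ⊆ NP/poly ⊆ (P/poly)/poly ⊆ P/poly`; Karp–Lipton 1982, §1;
Bürgisser 2000 TCS, p. 79). [cite: Burgisser2000TCS, p. 79 proof of Cor. 1.2] [cite: KarpLipton1980, §1] -/
theorem SigmaP_subset_PPoly_of_NP_subset_PPoly (h : Nondeterministic.NP ⊆ PPoly) : ∀ k : ℕ, SigmaP k ⊆ PPoly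
  | 0 => P_subset_PPoly_holds
  | k + 1 => by
    have ih := SigmaP_subset_PPoly_of_NP_subset_PPoly h k
    have hPi : PiP k ⊆ PPoly := by
      intro L hL
      have hc : Lᶜ ∈ PPoly := ih hL
      have : L ∈ co PPoly := by
        change Lᶜ ∈ PPoly
        exact hc
      rwa [co_PPoly_holds] at this
    rw [SigmaP_succ]
    calc polyExists (PiP k) ⊆ polyExists PPoly := polyExists_mono hPi
      _ ⊆ polyAdvice Nondeterministic.NP := polyExists_PPoly_subset_polyAdvice_NP
      _ ⊆ polyAdvice PPoly := polyAdvice_mono h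
      _ ⊆ PPoly := polyAdvice_PPoly_subset_PPoly

/-- **`NP ⊆ P/poly` implies `PH ⊆ P/poly`.** [cite: Burgisser2000TCS, p. 79 proof of Cor. 1.2] [cite: KarpLipton1980, §1] -/
theorem PH_subset_PPoly_of_NP_subset_PPoly (h : Nondeterministic.NP ⊆ PPoly) : PH ⊆ PPoly := by
  intro L hL
  obtain ⟨k, hk⟩ := Set.mem_iUnion.1 hL
  exact SigmaP_subset_PPoly_of_NP_subset_PPoly h k hk

/-- **`NP ⊆ P/poly` implies `PH/poly = P/poly-advice`** (`= P/poly` by Arora–Barak Thm. 6.18).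
[cite: Burgisser2000TCS, p. 79 proof of Cor. 1.2] -/
theorem polyAdvice_PH_eq_polyAdvice_P_of_NP_subset_PPoly (h : Nondeterministic.NP ⊆ PPoly) :
    polyAdvice PH = polyAdvice Classes.P := by
  refine Set.Subset.antisymm ?_ (polyAdvice_mono P_subset_PH)
  calc polyAdvice PH ⊆ polyAdvice PPoly := polyAdvice_mono (PH_subset_PPoly_of_NP_subset_PPoly h)
    _ ⊆ PPoly := polyAdvice_PPoly_subset_PPoly
    _ = polyAdvice Classes.P := PPoly_eq_polyAdvice_P_holds

/-- **Bürgisser's form: `P/poly = NP/poly` implies `P/poly = PH/poly`** (TCS 235, p. 79: "A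
similar argument shows that `P/poly = NP/poly` implies `P/poly = PH/poly`"), with
`P/poly = polyAdvice P` (Arora–Barak Thm. 6.18): from the hypothesis,
`NP ⊆ NP/poly = P/poly-advice = P/poly` (`NP_subset_polyAdvice_NP'`), and the previous theorem
applies. [cite: Burgisser2000TCS, p. 79 proof of Cor. 1.2] -/
theorem polyAdvice_P_eq_polyAdvice_PH_of_polyAdvice_P_eq_polyAdvice_NP
    (h : polyAdvice Classes.P = polyAdvice Nondeterministic.NP) : polyAdvice Classes.P = polyAdvice PH := by
  have hNP : Nondeterministic.NP ⊆ PPoly :=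
    calc Nondeterministic.NP ⊆ polyAdvice Nondeterministic.NP := NP_subset_polyAdvice_NP'
      _ = polyAdvice Classes.P := h.symm
      _ = PPoly := PPoly_eq_polyAdvice_P_holds.symm
  exact (polyAdvice_PH_eq_polyAdvice_P_of_NP_subset_PPoly hNP).symm

end Literature.Computability.Complexity
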